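import Literature.Analysis.ValidatedNumerics.IntervalLogArctan
import Literature.Analysis.ValidatedNumerics.IntervalFunctions
import HarnessLib

/-!
# THETA tier-1 kernel checker — ATOMS (arithmetic layer, part 1 of 2; cc-s2-1, WEIL typing lane; RH-FREE bookkeeping)

The tier-1 theta certificate of `THETA-CERT-cc6 §D` (D1–D9; plain Poisson majorant, B-spline order `m`, seed `(1/4, 3/5, 1)`,
`c₂ = 1`, cut width `η′ = 1/20`) decides, for a prime `q` with next prime `q⁺` and a shift `δ`, ONE inequality
`loss(q, q⁺, m, δ) < gain(q, m, δ)` between closed-form real expressions in `e^{±…}, log q, log 2, π, log 4π, √q` and exact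
rationals (Irwin–Hall values, `ζ`/`Λ`-sum majorants, the Rosser–Schoenfeld constant).  The kernel version (director-rh ruling,
HOME INBOX l.7328 (A)(i)) evaluates that inequality by VERIFIED interval arithmetic; this module is its first half:

* §1 rows, engine parameters, constants and the exact rational data (Irwin–Hall CDF `IH`, the gain's lower Riemann sum
  `Row.IloExact` and its termwise rounded-down value `Row.Ilo ≤ Row.IloExact`);
* §2 the twenty-one atoms of a row (`constAtoms`, `Row.rowAtoms`), their real values (`Atom.val`, `Row.vals`) and verified
  enclosures (`Atom.encl`, `Atom.enclNI`, `enclList`; inclusion `Atom.mem_encl`, `Atom.mem_enclNI`, `mem_xOf_of_enclList`).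

Nothing is re-proved about `exp`/`log`/`π`/`√`: the atoms are enclosed by the tree's multi-precision engine
`Literature.Analysis.ValidatedNumerics.NumericsMP.MI` (`MI.expPt`, `MI.logNat`, `MI.logTwo`, `MI.pi`, `MI.logPos`, each with its
inclusion theorem) at scale `2^64`, `√q` by the tree's Heron bounds `NonemptyInterval.sqrtI`; the enclosures are handed to the
tree's term language `RExpr` as rational intervals (part 2, `ThetaTier1Arith.lean`: the D1–D9 program, `checkAll`,
`checkAll_sound`).  Nothing here bears on the truth of RH (UC(q) is the RH-free upper-clause column).
-/

set_option linter.dupNamespace false  -- the mandated namespace repeats `RiemannHypothesis`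
set_option autoImplicit false

namespace Summit.RiemannHypothesis.RiemannHypothesis.Theorems.ThetaTier1

open Literature.Analysis.ValidatedNumerics
open Literature.Analysis.ValidatedNumerics.NumericsMP

/-! ## §1  Rows, engine parameters, constants, exact rational data -/

/-- One certificate row: the prime `q`, the next prime `qn`, the B-spline order `m`, the shift `δ = dnum/10¹²`
and the arch split point `t₀ = 2^{-k}`. [this cell, THETA-CERT-cc6 §D] -/
structure Row where
  /-- the prime -/
  q : ℕ
  /-- the next prime -/
  qn : ℕ
  /-- B-spline order -/
  m : ℕ
  /-- `δ · 10¹²` -/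
  dnum : ℕ
  /-- `t₀ = 2^{-k}` in the arch bound D7 -/
  k : ℕ

/-- The shift `δ = dnum / 10¹²`. [this cell, THETA-CERT-cc6 §0] -/
def Row.delta (r : Row) : ℚ := (r.dnum : ℚ) / 1000000000000

/-- The cut width `η′ = 1/20`. [this cell, THETA-CERT-cc6 §D tier 1] -/
def ETA : ℚ := 1 / 20

/-- Number of steps of the gain's lower Riemann sum. [this cell, THETA-KERNEL-QUOTE §2] -/
def JSTEPS : ℕ := 16

/-- Binary scale of the fixed-point atoms (`2^64`; the tightest side condition, the window `e^{2δ}q < q⁺`, has relative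
slack `≈ (q⁺-q)/(50q) ≥ 10⁻⁶`, and the verdict's worst relative margin is `0.35`). -/
def SCALE : ℕ := 2 ^ 64

/-- Dyadic precision of `RExpr.enclose` and of the square-root atom. -/
def PREC : ℕ := 64

/-- Heron steps for square roots (arguments in `[10⁻⁶, 10⁶]`: `≤ 11` halvings, then quadratic). -/
def HERON : ℕ := 18

/-- Taylor terms of `exp` after the argument is reduced to `|x| ≤ 1/16` (`16⁻¹²/12! < 2⁻⁶⁴`). -/
def KEXP : ℕ := 12

/-- Argument halvings for `e^a`: the least `k` with `16|a| < 2^k`, so that `|a|/2^k ≤ 1/16`. -/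
def expHalvings (a : ℚ) : ℕ := Nat.size ⌈|a| * 16⌉₊

/-- Series terms for the logarithms (`2·2⁻⁷³ < 2⁻⁶⁴` up to the factor lost in `log q = k log 2 - log(1-x)`). -/
def KLOG : ℕ := 72

/-- Machin terms for `π` (`5^{-33} < 2⁻⁶⁴`). -/
def KPI : ℕ := 16

/-- The scale is positive. [folklore] -/
theorem SCALE_pos : 0 < SCALE := by unfold SCALE; positivity

/-- Upper bounds for `ζ(m)`, `m = 4 … 8`, with a provability margin `≥ 2·10⁻⁵` (`ζ(4) = π⁴/90 = 1.08232…`,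
`ζ(5) = 1.03692…`, `ζ(6) = π⁶/945`, `ζ(7) = 1.00834…`, `ζ(8) = π⁸/9450`); their meaning is an obligation of the analytic
layer. [this cell, THETA-CERT-cc6 D1/D2] -/
def zetaHi (m : ℕ) : ℚ :=
  if m = 4 then 10824 / 10000 else if m = 5 then 10370 / 10000
  else if m = 6 then 10174 / 10000 else if m = 7 then 10084 / 10000
  else if m = 8 then 10041 / 10000 else 2

/-- Upper bounds `2^{-s}` for `Σ_n Λ(n) n^{-s}`, `s ≥ 5` (true values `0.0276, 0.0126, 0.0060, 0.0029` for `s = 5 … 8`;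
provable from `Λ(n) ≤ log n`; analytic-layer obligation). [this cell, THETA-CERT-cc6 D6] -/
def pLamHi (s : ℕ) : ℚ := 1 / 2 ^ s

/-- The Rosser–Schoenfeld constant `1.03883` (`ψ(x) < 1.03883 x`; analytic-layer obligation). [this cell, THETA-CERT-cc6 D6] -/
def RS : ℚ := 103883 / 100000

/-- Stand-in lower bound `1/2` for Euler's `γ` (analytic-layer obligation; Mathlib has `1/2 < γ`). [this cell, THETA-CERT-cc6 D7] -/
def GAMMA_LO : ℚ := 1 / 2

/-- Partial alternating sum `Σ_{j<k} (-1)^j C(m,j) (s-j)^m` of the Irwin–Hall CDF. [folklore] -/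
def ihSum (m : ℕ) (s : ℚ) : ℕ → ℚ
  | 0 => 0
  | j + 1 => ihSum m s j + (-1) ^ j * (Nat.choose m j : ℚ) * (s - j) ^ m

/-- The Irwin–Hall CDF `F_m(s) = (1/m!) Σ_{j ≤ ⌊s⌋} (-1)^j C(m,j)(s-j)^m` on `0 < s < m`, `0` left of `0`, `1` right of `m`
(exact rational). [folklore] -/
def IH (m : ℕ) (s : ℚ) : ℚ :=
  if s ≤ 0 then 0 else if (m : ℚ) ≤ s then 1 else ihSum m s (⌊s⌋.toNat + 1) / (Nat.factorial m : ℚ)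

/-- Top-layer value `R(τ) = F_m(mτ/2)`. [this cell, THETA-CERT-cc6 D4/D8] -/
def Rtop (m : ℕ) (τ : ℚ) : ℚ := IH m (m * τ / 2)

/-- The `j`-th term `(δ/J) R((w_j - w_j²/2)/(2δ)) R((s_j - s_j²/2)/(2δ))`, `w_j = δj/J`, `s_j = 2δ - δ(j+1)/J`, of the gain's
lower Riemann sum (exact rational). [this cell, THETA-CERT-cc6 D8] -/
def gainTerm (m : ℕ) (d : ℚ) (J j : ℕ) : ℚ :=
  d / J * Rtop m ((d * j / J - (d * j / J) * (d * j / J) / 2) / (2 * d)) *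
    Rtop m ((2 * d - d * (j + 1) / J - (2 * d - d * (j + 1) / J) * (2 * d - d * (j + 1) / J) / 2) / (2 * d))

/-- Exact lower Riemann sum `Σ_{j<n} gainTerm j`. [this cell, THETA-CERT-cc6 D8] -/
def gainSum (m : ℕ) (d : ℚ) (J : ℕ) : ℕ → ℚ
  | 0 => 0
  | j + 1 => gainSum m d J j + gainTerm m d J j

/-- The same sum with every term rounded DOWN to the dyadic grid `2⁻⁸⁰` (keeps the kernel's rationals small). [this cell] -/
def gainSumLo (m : ℕ) (d : ℚ) (J : ℕ) : ℕ → ℚ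
  | 0 => 0
  | j + 1 => gainSumLo m d J j + dyFloor 80 (gainTerm m d J j)

/-- The rounded sum is below the exact one. [this cell] -/
theorem gainSumLo_le (m : ℕ) (d : ℚ) (J : ℕ) : ∀ n, gainSumLo m d J n ≤ gainSum m d J n
  | 0 => le_rfl
  | n + 1 => add_le_add (gainSumLo_le m d J n) (dyFloor_le 80 _)

/-- `I_exact = 2 Σ_{j<J} gainTerm j` — the lower Riemann sum of the top-layer integral `I` with `J = 16` steps (exact rational;
the analytic layer proves `I ≥ I_exact`). [this cell, THETA-CERT-cc6 D8] -/
def Row.IloExact (r : Row) : ℚ := 2 * gainSum r.m r.delta JSTEPS JSTEPS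

/-- `I_lo` — the value the checker uses: the termwise rounded-down sum, `≤ I_exact`. [this cell, THETA-CERT-cc6 D8] -/
def Row.Ilo (r : Row) : ℚ := 2 * gainSumLo r.m r.delta JSTEPS JSTEPS

/-- `I_lo ≤ I_exact`. [this cell] -/
theorem Row.Ilo_le_IloExact (r : Row) : r.Ilo ≤ r.IloExact :=
  mul_le_mul_of_nonneg_left (gainSumLo_le _ _ _ _) (by norm_num)

/-- `ε = 2δ` (`c₂ = 1`). [this cell, THETA-CERT-cc6 §D] -/
def Row.eps (r : Row) : ℚ := 2 * r.delta

/-- `α = (c₂ - ε - m₀)/(m₀ - c₁ - ε)` for the seed `(1/4, 3/5, 1)`. [this cell, THETA-CERT-cc6 §D] -/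
def Row.alpha (r : Row) : ℚ := (1 - r.eps - 3 / 5) / (3 / 5 - 1 / 4 - r.eps)

/-- `Σ|c_i| = 2 + 2α`. [this cell, THETA-CERT-cc6 §D] -/
def Row.csum (r : Row) : ℚ := 2 + 2 * r.alpha

/-- `h_max = max(1, α)`. [this cell, THETA-CERT-cc6 §D] -/
def Row.hmax (r : Row) : ℚ := max 1 r.alpha

/-- `χ_L = F_m(2mδ/η′)`. [this cell, THETA-CERT-cc6 D4] -/
def Row.chiL (r : Row) : ℚ := IH r.m (2 * r.m * r.delta / ETA)

/-- `t₀ = 2^{-k}`. [this cell, THETA-CERT-cc6 D7] -/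
def Row.t0 (r : Row) : ℚ := 1 / 2 ^ r.k

/-! ## §2  The transcendental atoms of a row -/

/-- The five kinds of transcendental atoms the closed forms use. [this cell] -/
inductive Atom
  /-- `e^a`, `a` rational -/
  | exp (a : ℚ)
  /-- `log 2` -/
  | logTwo
  /-- `log n` -/
  | logNat (n : ℕ)
  /-- `π` -/
  | pi
  /-- `log (4π)` -/
  | logFourPi
  /-- `√n` -/
  | sqrtNat (n : ℕ)

/-- The real number an atom denotes. [this cell] -/
noncomputable def Atom.val : Atom → ℝ
  | .exp a => Real.exp a
  | .logTwo => Real.log 2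
  | .logNat n => Real.log n
  | .pi => Real.pi
  | .logFourPi => Real.log (4 * Real.pi)
  | .sqrtNat n => Real.sqrt n

/-- The verified fixed-point enclosure of a transcendental atom at scale `SCALE` (`none` on failure; the square root
is enclosed in `Atom.enclNI`). [this cell] -/
def Atom.encl : Atom → Option MI
  | .exp a => MI.expPt SCALE KEXP (expHalvings a) (MI.ofFrac SCALE a.num a.den)
  | .logTwo => MI.logTwo SCALE KLOG
  | .logNat n => MI.logNat SCALE KLOG n
  | .pi => MI.pi SCALE KPI
  | .logFourPi =>
      match MI.pi SCALE KPI with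
      | some P => MI.logPos SCALE KLOG (P.mulInt 4)
      | none => none
  | .sqrtNat _ => none

/-- **Inclusion for atoms**: a successful enclosure contains the atom's value. [this cell; `MI.mem_expPt`, `mem_logTwo`,
`mem_logNat`, `mem_pi`, `mem_logPos` of the tree] -/
theorem Atom.mem_encl {a : Atom} {I : MI} (h : a.encl = some I) : MI.mem SCALE a.val I := by
  cases a with
  | sqrtNat n => exact absurd h (by simp [Atom.encl])
  | exp a =>
      have hx : MI.mem SCALE ((a : ℚ) : ℝ) (MI.ofFrac SCALE a.num a.den) := by
        have := MI.mem_ofFrac SCALE a.num a.pos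
        rwa [← Rat.cast_def] at this
      exact MI.mem_expPt SCALE_pos h hx
  | logTwo => exact MI.mem_logTwo SCALE_pos h
  | logNat n => exact MI.mem_logNat SCALE_pos h
  | pi => exact MI.mem_pi SCALE h
  | logFourPi =>
      simp only [Atom.encl] at h
      split at h
      · rename_i P hP
        have h4 := (MI.mem_logPos SCALE_pos h (MI.mem_mulInt (MI.mem_pi SCALE hP) 4)).2
        simp only [Atom.val]
        convert h4 using 2
        push_cast
        ring
      · exact absurd h (by simp)

/-- An `MI` interval read as a rational interval (upper end forced `≥` lower end). [this cell] -/
def toNI (I : MI) : NonemptyInterval ℚ :=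
  ⟨((I.lo : ℚ) / SCALE, ((max I.lo I.hi : ℤ) : ℚ) / SCALE),
    div_le_div_of_nonneg_right (by exact_mod_cast le_max_left I.lo I.hi) (by unfold SCALE; positivity)⟩

/-- Inclusion transfers from `MI.mem` to the rational interval. [this cell] -/
theorem mem_toNI {x : ℝ} {I : MI} (h : MI.mem SCALE x I) : x ∈ (toNI I).ratCast ℝ := by
  have hS : (0 : ℝ) < SCALE := by exact_mod_cast SCALE_pos
  rw [NonemptyInterval.mem_ratCast_iff]
  obtain ⟨h1, h2⟩ := h
  constructor
  · show (((I.lo : ℚ) / SCALE : ℚ) : ℝ) ≤ x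
    push_cast
    rw [div_le_iff₀ hS]
    exact h1
  · show x ≤ ((((max I.lo I.hi : ℤ) : ℚ) / SCALE : ℚ) : ℝ)
    push_cast
    rw [le_div_iff₀ hS]
    exact h2.trans (by exact_mod_cast le_max_right I.lo I.hi)

/-- The rational-interval enclosure of an atom: the fixed-point one read as rationals, or Heron bounds for `√n`
(`NonemptyInterval.sqrtI` of the tree). [this cell] -/
def Atom.enclNI (a : Atom) : Option (NonemptyInterval ℚ) :=
  match a with
  | .sqrtNat n => some ((NonemptyInterval.pure (n : ℚ)).sqrtI PREC HERON)
  | _ => (a.encl).map toNI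

/-- **Inclusion for atoms, rational form.** [this cell; `NonemptyInterval.sqrt_mem_sqrtI` of the tree for `√n`] -/
theorem Atom.mem_enclNI {a : Atom} {I : NonemptyInterval ℚ} (h : a.enclNI = some I) : a.val ∈ I.ratCast ℝ := by
  by_cases hs : ∃ n, a = .sqrtNat n
  · obtain ⟨n, rfl⟩ := hs
    simp only [Atom.enclNI, Option.some.injEq] at h
    subst h
    refine NonemptyInterval.sqrt_mem_sqrtI PREC HERON ?_
    rw [NonemptyInterval.ratCast_pure, Rat.cast_natCast]
    exact NonemptyInterval.mem_pure_self _
  · have h' : (a.encl).map toNI = some I := by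
      cases a <;> simp_all [Atom.enclNI]
    obtain ⟨J, hJ, rfl⟩ := Option.map_eq_some_iff.1 h'
    exact mem_toNI (Atom.mem_encl hJ)

/-- Enclose a list of atoms (all or nothing). [this cell] -/
def enclList : List Atom → Option (List (NonemptyInterval ℚ))
  | [] => some []
  | a :: as =>
      match a.enclNI, enclList as with
      | some I, some Is => some (I :: Is)
      | _, _ => none

/-- The variable assignment of `RExpr` read off a list of enclosures (default `[0, 0]` beyond the list). [this cell] -/
def xOf (Is : List (NonemptyInterval ℚ)) (i : ℕ) : NonemptyInterval ℚ := Is.getD i (NonemptyInterval.pure 0)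

/-- The real values of a list of atoms as an `RExpr` environment (default `0` beyond the list). [this cell] -/
noncomputable def valOf (as : List Atom) (i : ℕ) : ℝ := (as.map Atom.val).getD i 0

/-- **Inclusion for atom lists**: every coordinate of the environment lies in its enclosure. [this cell] -/
theorem mem_xOf_of_enclList : ∀ {as : List Atom} {Is : List (NonemptyInterval ℚ)}, enclList as = some Is →
    ∀ i, valOf as i ∈ (xOf Is i).ratCast ℝ
  | [], Is, h, i => by
      simp only [enclList, Option.some.injEq] at h
      subst h
      simp [valOf, xOf, NonemptyInterval.mem_ratCast_iff]
  | a :: as, Is, h, i => by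
      simp only [enclList] at h
      split at h
      · rename_i I Is' hI hIs
        simp only [Option.some.injEq] at h
        subst h
        cases i with
        | zero => simpa [valOf, xOf] using Atom.mem_enclNI hI
        | succ i => simpa [valOf, xOf] using mem_xOf_of_enclList hIs i
      · exact absurd h (by simp)

/-- `enclList` preserves the length. [this cell] -/
theorem length_enclList : ∀ {as : List Atom} {Is : List (NonemptyInterval ℚ)}, enclList as = some Is →
    Is.length = as.length
  | [], Is, h => by
      simp only [enclList, Option.some.injEq] at h
      subst h; rfl
  | a :: as, Is, h => by
      simp only [enclList] at h
      split at h
      · rename_i I Is' hI hIs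
        simp only [Option.some.injEq] at h
        subst h
        simp [length_enclList hIs]
      · exact absurd h (by simp)

/-- The twelve ROW-INDEPENDENT atoms (registers `0 … 11`):
`0 e^{1/2} · 1–6 e^{-(4j+1)/2} (j = 0…5) · 7 e^{-25/2} · 8 e^{-2} · 9 log 2 · 10 π · 11 log 4π`. [this cell] -/
def constAtoms : List Atom :=
  [ .exp (1 / 2), .exp (-1 / 2), .exp (-5 / 2), .exp (-9 / 2), .exp (-13 / 2), .exp (-17 / 2), .exp (-21 / 2),
    .exp (-25 / 2), .exp (-2), .logTwo, .pi, .logFourPi ]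

/-- The nine ROW atoms (registers `12 … 20`):
`12 e^{2δ} · 13 e^{δ} · 14 e^{2δ-η′} · 15 e^{η′-δ} · 16 e^{-m/(m+1)} · 17 e^{t₀/2} · 18 e^{m(2δ-η′)} · 19 log q · 20 √q`. [this cell] -/
def Row.rowAtoms (r : Row) : List Atom :=
  [ .exp (2 * r.delta), .exp r.delta, .exp (2 * r.delta - ETA), .exp (ETA - r.delta), .exp (-(r.m : ℚ) / (r.m + 1)),
    .exp (r.t0 / 2), .exp (r.m * (2 * r.delta - ETA)), .logNat r.q, .sqrtNat r.q ]

/-- All atoms of a row: the constants, then the row atoms (registers `0 … 20`). [this cell] -/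
def Row.atoms (r : Row) : List Atom := constAtoms ++ r.rowAtoms

/-- `enclList` of an append. [this cell] -/
theorem enclList_append : ∀ {as bs : List Atom} {Is Js : List (NonemptyInterval ℚ)},
    enclList as = some Is → enclList bs = some Js → enclList (as ++ bs) = some (Is ++ Js)
  | [], bs, Is, Js, h, h' => by
      simp only [enclList, Option.some.injEq] at h
      subst h; simpa using h'
  | a :: as, bs, Is, Js, h, h' => by
      simp only [enclList] at h
      split at h
      · rename_i I Is' hI hIs
        simp only [Option.some.injEq] at h
        subst h
        simp [enclList, hI, enclList_append hIs h']
      · exact absurd h (by simp)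

/-- The real environment of a row. [this cell] -/
noncomputable def Row.vals (r : Row) : ℕ → ℝ := valOf r.atoms

end Summit.RiemannHypothesis.RiemannHypothesis.Theorems.ThetaTier1
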